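/-
Copyright (c) 2026 the pub-hodgecm-mathlib formalisation cell (harness21).  Prover seat hodgecm-mathlib-LH4-p14 (g6), 2026-09-04 — STAGE-1b (β-BAL) road, dealer∕pen LH4-plan (g13)
WORD #86: brick (β-BAL-3) = B3 «THE BINARY NORM-FORM CHARACTER COUNT», FILE 1 of 2 (LH4-p11 (g8) SCOPE-betaBAL v1 §2 (iv) ∕ SPEC-B2 §3 (B2b-2); SIG `SIG-B3-…v1` 5f694337).
-/
import Literature.NumberTheory.LocalFields.WildQuadraticDatumNormSignConductor   -- ★ (LH4-p06 (g3)) the ω-conductor toolkit: `normSign_eq_of_near`, `sum_normSign_repr_eq_zero` (the non-norm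
                                                                                  -- involution), `normSign_mul_eq_neg_of_not_norm`; brings ★ #0a `IsRamifiedQuadraticDatum`, `normSign`
import HarnessLib

/-!
# Crux `H413`, line LH4 «(D-RAM) FOUR-FRAME», STAGE-1b (β-BAL) — B3 «THE BINARY NORM-FORM CHARACTER COUNT», FILE 1: the full regime and the F-SIDE character sums
# `Σ_a ω(C₀ + C₁ϖ_F^j a)` over the fixed unit classes (the «zero» level `1 ≤ j ≤ d − 2` and the conductor level `j = d − 1`)

Cell `hodgecm-mathlib` (D-0151), FLOOR 0, crux item H413 = `stmt-HodgeConjecture-24833`, route `HCCMUnconditional`; squad LH4; lane `--supports stmt-HodgeConjecture-24833 --as helper`.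
THEOREMS ONLY (no `def`, no instance, no `sorry`, default heartbeats); pure local arithmetic of a ramified quadratic datum `(σ, ϖ; d, t)` on ONE valued field `K` (`F = K^σ` = the fixed
elements); nothing about lattices.  COUNT-NEUTRAL.

THE OBJECT (LH4-p11 (g8) 12:47:56Z (Q1)–(Q3)).  On an HNF stratum `latt V`, `V = [[1,0,0],[x,p,0],[y,z,r]]`, the transvection label is the norm class of the binary norm-form value
`C₀ + C₁·N(x)` of the glue unit `x` (★ (L-lab-12)); the labelled stratum census of (β-BAL) Stage B is the SIGNED CHARACTER COUNT `S_j(s) = Σ_{r ∈ R, |r| = 1} ω(C₀ + C₁ϖ_F^jN(r))`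
over a complete irredundant residue system `R` of `𝒪_K` mod `ϖ^s` (`ω = normSign σ`, `N r = rσr`, `ϖ_F = ϖσϖ`, `C₀, C₁` fixed units).  Regimes (the conductor exponent of `ω` on the
fixed units is `d`: ★ toolkit — `ω ≡ 1` on `U_F(2d−1)`, a fixed non-norm `c` in `U_F(2d−2)`): «full» `j ≥ d`, «zero» `1 ≤ j ≤ d − 2`, «across the conductor» `j = d − 1`, conic `j = 0`.
THIS FILE:
* §1 (A) `sum_normSign_binaryNormForm_of_le` — FULL REGIME `d ≤ j`: every term is `ω(C₀)`, the sum over ANY finite set of integral `r` is `#R · ω(C₀)` (★ `normSign_eq_of_near`).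
* §2 THE F-SIDE SUMS over an abstract complete irredundant system `A` of representatives of the fixed units (resp. `A₀`: fixed integral elements) — carrier-agnostic, as (Q2):
  `sum_normSign_affine_repr_eq_zero` («zero» level: the values `C₀ + C₁ϖ_F^j a`, `a ∈ A` mod `|ϖ|^{2(d−j)}`, represent `{y fixed : |y − C₀| = |ϖ|^{2j}}` modulo `𝔭^{2d}`, a
  `U_F(2d−2)`-stable set, so ★ `sum_normSign_repr_eq_zero` — the non-norm involution `y ↦ c·y`, i.e. `n ↦ c·n + C₀(c−1)(C₁ϖ_F^j)⁻¹` — kills the sum);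
  `sum_normSign_affine_repr_conductor_eq_zero` (`j = d − 1`, all residues mod `|ϖ|²`: the values represent `C₀·U_F(2d−2)`), and its unit part
  `sum_units_normSign_affine_repr_conductor` (`= −#{zero class}·ω(C₀)`).
FILE 2 (`F0P3cDyRamBinaryNormFormCharCount`) carries these to the residues of `K` (uniform fibres of the norm, regrouping) and states (B) `S_j(s) = 0` and (C) `(q−1)·S_{d−1}(s) = −ω(C₀)·#R^×`.
HONEST LABEL.  Count-neutral; (β-BAL), (A″), (β), T₊ stay OPEN; HC_CM is proved only modulo the 7 printed citations (2 remaining named inputs: hLiu418 = `stmt-HodgeConjecture-24832`,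
h413 = `stmt-HodgeConjecture-24833`) until rung 0 closes.

## References
* [Serre1979] J.-P. Serre, *Local Fields*, GTM 67 (1979) — Ch. V §3 Prop. 5, Cor. 2–3 (norm groups of a totally ramified quadratic extension; the conductor), Ch. XV §2.
* [NeukirchANT1999] J. Neukirch, *Algebraic Number Theory* (1999) — Ch. V (1.3) (local norm index).
-/

set_option autoImplicit false

noncomputable section

namespace Summit.HodgeConjecture.HodgeConjecture.Cruxes.H413.F0P3cDyRamBinaryNormFormFixedSums

open WithZero
open scoped Valued
open Literature.NumberTheory.Automorphic.UnitaryThreeFourFrame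
open Literature.NumberTheory.LocalFields.WildQuadraticDatum

variable {K : Type} [Field K] [Valued K ℤᵐ⁰] {σ : K →+* K} {ϖ : K} {d t : ℕ}

/-! ## §1  (A) The full regime `j ≥ d`: every term is `ω(C₀)` -/

omit [Valued K ℤᵐ⁰] in
/-- The binary norm-form value `C₀ + C₁·ϖ_F^j·N(r)` is σ-fixed (`σ` an involution, `C₀, C₁` fixed, `ϖ_F = ϖσϖ`, `N r = rσr`). [cite: Serre1979, Ch. V §3] -/
theorem map_binaryNormForm (hσσ : ∀ x, σ (σ x) = x) {C₀ C₁ : K} (hσC₀ : σ C₀ = C₀) (hσC₁ : σ C₁ = C₁) (j : ℕ) (r : K) :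
    σ (C₀ + C₁ * (ϖ * σ ϖ) ^ j * (r * σ r)) = C₀ + C₁ * (ϖ * σ ϖ) ^ j * (r * σ r) := by
  simp only [map_add, map_mul, map_pow, hσσ, hσC₀, hσC₁]
  ring

/-- **(A) THE FULL REGIME.**  Ramified quadratic datum on a complete `K`; `C₀` a fixed unit, `C₁` fixed integral, `d ≤ j`: then `|C₁ϖ_F^jN(r)| ≤ |ϖ|^{2d−1}` for every integral `r`, so
`ω(C₀ + C₁ϖ_F^jN(r)) = ω(C₀)` (★ `normSign_eq_of_near`) and over ANY finite set `R` of integral elements **`Σ_{r ∈ R} ω(C₀ + C₁ϖ_F^jN r) = #R · ω(C₀)`** — in particular over the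
unit part of a residue system («full»: the progression sits inside the conductor). [cite: Serre1979, Ch. XV §2; Ch. V §3 Cor. 3] -/
theorem sum_normSign_binaryNormForm_of_le [CompleteSpace K] (hD : IsRamifiedQuadraticDatum σ ϖ d t)
    {C₀ C₁ : K} (hσC₀ : σ C₀ = C₀) (hC₀ : Valued.v C₀ = 1) (hσC₁ : σ C₁ = C₁) (hC₁ : Valued.v C₁ ≤ 1) {j : ℕ} (hj : d ≤ j)
    (R : Finset K) (hR₁ : ∀ r ∈ R, Valued.v r ≤ 1) :
    ∑ r ∈ R, normSign σ (C₀ + C₁ * (ϖ * σ ϖ) ^ j * (r * σ r)) = (R.card : ℤ) * normSign σ C₀ := by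
  obtain ⟨hσ, hvσ, hϖ, -, -, -, -⟩ := id hD
  have hϖ1 : Valued.v ϖ ≤ 1 := by rw [hϖ, ← exp_zero]; exact exp_le_exp.2 (by norm_num)
  have hterm : ∀ r ∈ R, normSign σ (C₀ + C₁ * (ϖ * σ ϖ) ^ j * (r * σ r)) = normSign σ C₀ := by
    intro r hr
    refine normSign_eq_of_near hD hσC₀ (map_binaryNormForm hσ hσC₀ hσC₁ j r) hC₀ (n := 2 * d - 1) le_rfl ?_
    rw [show C₀ - (C₀ + C₁ * (ϖ * σ ϖ) ^ j * (r * σ r)) = -(C₁ * (ϖ * σ ϖ) ^ j * (r * σ r)) by ring, Valuation.map_neg,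
      map_mul, map_mul, map_pow, map_mul, hvσ, map_mul, hvσ, ← pow_two, ← pow_mul]
    calc Valued.v C₁ * Valued.v ϖ ^ (2 * j) * (Valued.v r * Valued.v r)
        ≤ 1 * Valued.v ϖ ^ (2 * j) * (1 * 1) := by gcongr <;> first | exact hC₁ | exact hR₁ r hr
      _ = Valued.v ϖ ^ (2 * j) := by rw [one_mul, mul_one, mul_one]
      _ ≤ Valued.v ϖ ^ (2 * d - 1) := pow_le_pow_right_of_le_one' hϖ1 (by omega)
  rw [Finset.sum_congr rfl hterm, Finset.sum_const, nsmul_eq_mul]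

/-! ## §2  The F-side character sums: the «zero» level `1 ≤ j ≤ d − 2` and the conductor level `j = d − 1` -/

/-- **THE F-SIDE SUM VANISHES IN THE «ZERO» REGIME.**  Ramified datum on a complete `K` with finite residue field, `|2| < 1`; `C₀, C₁` fixed units; `1 ≤ j`, `j + 2 ≤ d`; `A` a finite set of
fixed units which is a COMPLETE IRREDUNDANT system of representatives of the fixed units modulo `|ϖ|^{2(d−j)}`.  Then **`Σ_{a ∈ A} ω(C₀ + C₁ϖ_F^j a) = 0`**: the values form a complete
irredundant system of representatives modulo `𝔭^{2d}` of the set `{y fixed : |y − C₀| = |ϖ|^{2j}}`, which is stable under `U_F(2d−2)` (`2j < 2d − 2`), and ★ `sum_normSign_repr_eq_zero` (the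
non-norm involution) applies. [cite: Serre1979, Ch. V §3 Cor. 3; Ch. XV §2] -/
theorem sum_normSign_affine_repr_eq_zero [CompleteSpace K] [Finite 𝓀[K]] (hD : IsRamifiedQuadraticDatum σ ϖ d t) (h2v : Valued.v (2 : K) < 1)
    {C₀ C₁ : K} (hσC₀ : σ C₀ = C₀) (hC₀ : Valued.v C₀ = 1) (hσC₁ : σ C₁ = C₁) (hC₁ : Valued.v C₁ = 1) {j : ℕ} (hj : 1 ≤ j) (hjd : j + 2 ≤ d)
    (A : Finset K) (hA₁ : ∀ a ∈ A, σ a = a ∧ Valued.v a = 1)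
    (hA₂ : ∀ u : K, σ u = u → Valued.v u = 1 → ∃ a ∈ A, Valued.v (u - a) ≤ Valued.v ϖ ^ (2 * (d - j)))
    (hA₃ : ∀ a ∈ A, ∀ a' ∈ A, Valued.v (a - a') ≤ Valued.v ϖ ^ (2 * (d - j)) → a = a') :
    ∑ a ∈ A, normSign σ (C₀ + C₁ * (ϖ * σ ϖ) ^ j * a) = 0 := by
  classical
  obtain ⟨hσ, hvσ, hϖ, -, -, -, -⟩ := id hD
  have hϖ0 : Valued.v ϖ ≠ 0 := by rw [hϖ]; exact exp_ne_zero
  have hP : Valued.v (C₁ * (ϖ * σ ϖ) ^ j) = Valued.v ϖ ^ (2 * j) := by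
    rw [map_mul, hC₁, one_mul, map_pow, map_mul, hvσ, ← pow_two, ← pow_mul]
  have hP0 : C₁ * (ϖ * σ ϖ) ^ j ≠ 0 := fun h => by
    rw [h, map_zero] at hP; exact pow_ne_zero _ hϖ0 hP.symm
  have hσP : σ (C₁ * (ϖ * σ ϖ) ^ j) = C₁ * (ϖ * σ ϖ) ^ j := by rw [map_mul, map_pow, map_mul, hσ, hσC₁, mul_comm (σ ϖ) ϖ]
  -- the set `A' = {y fixed : |y − C₀| = |ϖ|^{2j}}` and its stability under `U_F(2d−2)`
  let A' : Set K := {y | σ y = y ∧ Valued.v (y - C₀) = Valued.v ϖ ^ (2 * j)}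
  have h2j : Valued.v ϖ ^ (2 * j) < 1 := by
    rw [hϖ, ← exp_nsmul, nsmul_eq_mul, mul_neg, mul_one, ← exp_zero]; exact exp_lt_exp.2 (by omega)
  have hA'u : ∀ y ∈ A', σ y = y ∧ Valued.v y = 1 := by
    rintro y ⟨hσy, hy⟩
    refine ⟨hσy, ?_⟩
    rw [show y = C₀ + (y - C₀) by ring, Valuation.map_add_eq_of_lt_left _ (by rw [hC₀, hy]; exact h2j), hC₀]
  have hA'st : ∀ y ∈ A', ∀ u : K, σ u = u → Valued.v u = 1 → Valued.v (u - 1) ≤ exp (-(2 * ((d - 1 : ℕ) : ℤ))) → u * y ∈ A' := by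
    rintro y ⟨hσy, hy⟩ u hσu hu1 hud
    refine ⟨by rw [map_mul, hσu, hσy], ?_⟩
    have hsplit : u * y - C₀ = (y - C₀) * u + C₀ * (u - 1) := by ring
    have hlt : Valued.v (C₀ * (u - 1)) < Valued.v ((y - C₀) * u) := by
      rw [map_mul, hC₀, one_mul, map_mul, hy, hu1, mul_one]
      refine lt_of_le_of_lt hud ?_
      rw [hϖ, ← exp_nsmul, nsmul_eq_mul, mul_neg, mul_one]
      exact exp_lt_exp.2 (by push_cast; omega)
    rw [hsplit, Valuation.map_add_eq_of_lt_left _ hlt, map_mul, hy, hu1, mul_one]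
  -- `S := image of A` is a complete irredundant system of representatives of `A'` modulo `𝔭^{2d}`
  let g : K → K := fun a => C₀ + C₁ * (ϖ * σ ϖ) ^ j * a
  have hg_inj : Set.InjOn g ↑A := by
    intro a _ a' _ h
    have h' : C₁ * (ϖ * σ ϖ) ^ j * a = C₁ * (ϖ * σ ϖ) ^ j * a' := by simpa [g] using h
    exact mul_left_cancel₀ hP0 h'
  have hS1 : ∀ y ∈ A.image g, y ∈ A' := by
    intro y hy
    obtain ⟨a, ha, rfl⟩ := Finset.mem_image.1 hy
    obtain ⟨hσa, ha1⟩ := hA₁ a ha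
    refine ⟨by simp only [g, map_add, hσC₀, map_mul, hσP, hσa], ?_⟩
    simp only [g, add_sub_cancel_left, map_mul, ha1, mul_one]
    rw [← map_mul, hP]
  have hS2 : ∀ y ∈ A', ∃ y' ∈ A.image g, Valued.v (y - y') ≤ Valued.v ϖ ^ (2 * d) := by
    rintro y ⟨hσy, hy⟩
    -- `u := (y − C₀) ∕ (C₁ϖ_F^j)` is a fixed unit
    set u := (y - C₀) * (C₁ * (ϖ * σ ϖ) ^ j)⁻¹ with hu
    have hσu : σ u = u := by rw [hu, map_mul, map_inv₀, map_sub, hσy, hσC₀, hσP]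
    have hu1 : Valued.v u = 1 := by
      rw [hu, map_mul, map_inv₀, hy, hP, mul_inv_cancel₀ (pow_ne_zero _ hϖ0)]
    obtain ⟨a, ha, hua⟩ := hA₂ u hσu hu1
    refine ⟨g a, Finset.mem_image.2 ⟨a, ha, rfl⟩, ?_⟩
    have hPu : C₁ * (ϖ * σ ϖ) ^ j * u = y - C₀ := by rw [hu, mul_comm, mul_assoc, inv_mul_cancel₀ hP0, mul_one]
    have e1 : y - g a = C₁ * (ϖ * σ ϖ) ^ j * (u - a) := by rw [mul_sub, hPu]; simp only [g]; ring
    rw [e1, map_mul, hP]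
    calc Valued.v ϖ ^ (2 * j) * Valued.v (u - a) ≤ Valued.v ϖ ^ (2 * j) * Valued.v ϖ ^ (2 * (d - j)) := mul_le_mul' le_rfl hua
      _ = Valued.v ϖ ^ (2 * d) := by rw [← pow_add]; congr 1; omega
  have hS3 : ∀ y ∈ A.image g, ∀ y' ∈ A.image g, Valued.v (y - y') ≤ Valued.v ϖ ^ (2 * d) → y = y' := by
    intro y hy y' hy' hyy
    obtain ⟨a, ha, rfl⟩ := Finset.mem_image.1 hy
    obtain ⟨a', ha', rfl⟩ := Finset.mem_image.1 hy'
    have e1 : g a - g a' = C₁ * (ϖ * σ ϖ) ^ j * (a - a') := by simp only [g]; ring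
    rw [e1, map_mul, hP] at hyy
    have hpj0 : Valued.v ϖ ^ (2 * j) ≠ 0 := pow_ne_zero _ hϖ0
    have haa : Valued.v (a - a') ≤ Valued.v ϖ ^ (2 * (d - j)) := by
      have h1 : Valued.v (a - a') = Valued.v ϖ ^ (2 * j) * Valued.v (a - a') * (Valued.v ϖ ^ (2 * j))⁻¹ := by
        rw [mul_comm (Valued.v ϖ ^ (2 * j)), mul_assoc, mul_inv_cancel₀ hpj0, mul_one]
      rw [h1, show 2 * (d - j) = 2 * d - 2 * j by omega, pow_sub₀ _ hϖ0 (by omega : 2 * j ≤ 2 * d)]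
      exact mul_le_mul_left hyy _
    exact congrArg g (hA₃ a ha a' ha' haa)
  have h0 := sum_normSign_repr_eq_zero hD h2v (ρ := 2 * d) (by omega) hA'u hA'st (A.image g) hS1 hS2 hS3
  rwa [Finset.sum_image hg_inj] at h0

/-- **THE F-SIDE SUM ACROSS THE CONDUCTOR (`j = d − 1`), ALL RESIDUES.**  `C₀, C₁` fixed units, `2 ≤ d`; `A₀` a complete irredundant system of representatives of the fixed INTEGRAL
elements modulo `|ϖ|²` (the `q − 1` unit classes and the zero class).  Then **`Σ_{a ∈ A₀} ω(C₀ + C₁ϖ_F^{d−1} a) = 0`** — the values represent `C₀·U_F(2d−2)` modulo `𝔭^{2d}`, a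
`U_F(2d−2)`-stable set, ★ `sum_normSign_repr_eq_zero`. [cite: Serre1979, Ch. V §3 Cor. 3; Ch. XV §2] -/
theorem sum_normSign_affine_repr_conductor_eq_zero [CompleteSpace K] [Finite 𝓀[K]] (hD : IsRamifiedQuadraticDatum σ ϖ d t) (h2v : Valued.v (2 : K) < 1)
    {C₀ C₁ : K} (hσC₀ : σ C₀ = C₀) (hC₀ : Valued.v C₀ = 1) (hσC₁ : σ C₁ = C₁) (hC₁ : Valued.v C₁ = 1) (hd : 2 ≤ d)
    (A₀ : Finset K) (hA₁ : ∀ a ∈ A₀, σ a = a ∧ Valued.v a ≤ 1)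
    (hA₂ : ∀ u : K, σ u = u → Valued.v u ≤ 1 → ∃ a ∈ A₀, Valued.v (u - a) ≤ Valued.v ϖ ^ 2)
    (hA₃ : ∀ a ∈ A₀, ∀ a' ∈ A₀, Valued.v (a - a') ≤ Valued.v ϖ ^ 2 → a = a') :
    ∑ a ∈ A₀, normSign σ (C₀ + C₁ * (ϖ * σ ϖ) ^ (d - 1) * a) = 0 := by
  classical
  obtain ⟨hσ, hvσ, hϖ, -, -, -, -⟩ := id hD
  have hϖ0 : Valued.v ϖ ≠ 0 := by rw [hϖ]; exact exp_ne_zero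
  have hP : Valued.v (C₁ * (ϖ * σ ϖ) ^ (d - 1)) = Valued.v ϖ ^ (2 * (d - 1)) := by
    rw [map_mul, hC₁, one_mul, map_pow, map_mul, hvσ, ← pow_two, ← pow_mul]
  have hP0 : C₁ * (ϖ * σ ϖ) ^ (d - 1) ≠ 0 := fun h => by
    rw [h, map_zero] at hP; exact pow_ne_zero _ hϖ0 hP.symm
  have hσP : σ (C₁ * (ϖ * σ ϖ) ^ (d - 1)) = C₁ * (ϖ * σ ϖ) ^ (d - 1) := by rw [map_mul, map_pow, map_mul, hσ, hσC₁, mul_comm (σ ϖ) ϖ]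
  have hexp : Valued.v ϖ ^ (2 * (d - 1)) = exp (-(2 * ((d - 1 : ℕ) : ℤ))) := by
    rw [hϖ, ← exp_nsmul, nsmul_eq_mul, mul_neg, mul_one]; norm_cast
  have h2d2 : Valued.v ϖ ^ (2 * (d - 1)) < 1 := by
    rw [hexp, ← exp_zero]; exact exp_lt_exp.2 (by omega)
  -- `A'' = C₀ · U_F(2d−2) = {y fixed : |y − C₀| ≤ |ϖ|^{2d−2}}`
  let A' : Set K := {y | σ y = y ∧ Valued.v (y - C₀) ≤ Valued.v ϖ ^ (2 * (d - 1))}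
  have hA'u : ∀ y ∈ A', σ y = y ∧ Valued.v y = 1 := by
    rintro y ⟨hσy, hy⟩
    refine ⟨hσy, ?_⟩
    rw [show y = C₀ + (y - C₀) by ring, Valuation.map_add_eq_of_lt_left _ (by rw [hC₀]; exact lt_of_le_of_lt hy h2d2), hC₀]
  have hA'st : ∀ y ∈ A', ∀ u : K, σ u = u → Valued.v u = 1 → Valued.v (u - 1) ≤ exp (-(2 * ((d - 1 : ℕ) : ℤ))) → u * y ∈ A' := by
    rintro y ⟨hσy, hy⟩ u hσu hu1 hud
    refine ⟨by rw [map_mul, hσu, hσy], ?_⟩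
    rw [show u * y - C₀ = (y - C₀) * u + C₀ * (u - 1) by ring]
    refine (Valuation.map_add _ _ _).trans (max_le ?_ ?_)
    · rw [map_mul, hu1, mul_one]; exact hy
    · rw [map_mul, hC₀, one_mul, hexp]; exact hud
  let g : K → K := fun a => C₀ + C₁ * (ϖ * σ ϖ) ^ (d - 1) * a
  have hg_inj : Set.InjOn g ↑A₀ := by
    intro a _ a' _ h
    have h' : C₁ * (ϖ * σ ϖ) ^ (d - 1) * a = C₁ * (ϖ * σ ϖ) ^ (d - 1) * a' := by simpa [g] using h
    exact mul_left_cancel₀ hP0 h'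
  have hS1 : ∀ y ∈ A₀.image g, y ∈ A' := by
    intro y hy
    obtain ⟨a, ha, rfl⟩ := Finset.mem_image.1 hy
    obtain ⟨hσa, ha1⟩ := hA₁ a ha
    refine ⟨by simp only [g, map_add, hσC₀, map_mul, hσP, hσa], ?_⟩
    simp only [g, add_sub_cancel_left]
    rw [map_mul, hP]
    exact mul_le_of_le_one_right' ha1
  have hS2 : ∀ y ∈ A', ∃ y' ∈ A₀.image g, Valued.v (y - y') ≤ Valued.v ϖ ^ (2 * d) := by
    rintro y ⟨hσy, hy⟩
    set u := (y - C₀) * (C₁ * (ϖ * σ ϖ) ^ (d - 1))⁻¹ with hu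
    have hσu : σ u = u := by rw [hu, map_mul, map_inv₀, map_sub, hσy, hσC₀, hσP]
    have hu1 : Valued.v u ≤ 1 := by
      rw [hu, map_mul, map_inv₀, hP]
      calc Valued.v (y - C₀) * (Valued.v ϖ ^ (2 * (d - 1)))⁻¹ ≤ Valued.v ϖ ^ (2 * (d - 1)) * (Valued.v ϖ ^ (2 * (d - 1)))⁻¹ := mul_le_mul_left hy _
        _ = 1 := mul_inv_cancel₀ (pow_ne_zero _ hϖ0)
    obtain ⟨a, ha, hua⟩ := hA₂ u hσu hu1
    refine ⟨g a, Finset.mem_image.2 ⟨a, ha, rfl⟩, ?_⟩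
    have hPu : C₁ * (ϖ * σ ϖ) ^ (d - 1) * u = y - C₀ := by rw [hu, mul_comm, mul_assoc, inv_mul_cancel₀ hP0, mul_one]
    have e1 : y - g a = C₁ * (ϖ * σ ϖ) ^ (d - 1) * (u - a) := by rw [mul_sub, hPu]; simp only [g]; ring
    rw [e1, map_mul, hP]
    calc Valued.v ϖ ^ (2 * (d - 1)) * Valued.v (u - a) ≤ Valued.v ϖ ^ (2 * (d - 1)) * Valued.v ϖ ^ 2 := mul_le_mul' le_rfl hua
      _ = Valued.v ϖ ^ (2 * d) := by rw [← pow_add]; congr 1; omega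
  have hS3 : ∀ y ∈ A₀.image g, ∀ y' ∈ A₀.image g, Valued.v (y - y') ≤ Valued.v ϖ ^ (2 * d) → y = y' := by
    intro y hy y' hy' hyy
    obtain ⟨a, ha, rfl⟩ := Finset.mem_image.1 hy
    obtain ⟨a', ha', rfl⟩ := Finset.mem_image.1 hy'
    have e1 : g a - g a' = C₁ * (ϖ * σ ϖ) ^ (d - 1) * (a - a') := by simp only [g]; ring
    rw [e1, map_mul, hP] at hyy
    have hpj0 : Valued.v ϖ ^ (2 * (d - 1)) ≠ 0 := pow_ne_zero _ hϖ0
    have haa : Valued.v (a - a') ≤ Valued.v ϖ ^ 2 := by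
      have key : Valued.v ϖ ^ (2 * (d - 1)) * Valued.v (a - a') ≤ Valued.v ϖ ^ (2 * (d - 1)) * Valued.v ϖ ^ 2 := by
        calc _ ≤ Valued.v ϖ ^ (2 * d) := hyy
          _ = Valued.v ϖ ^ (2 * (d - 1)) * Valued.v ϖ ^ 2 := by rw [← pow_add]; congr 1; omega
      have h2 := mul_le_mul_right key (Valued.v ϖ ^ (2 * (d - 1)))⁻¹
      rwa [inv_mul_cancel_left₀ hpj0, inv_mul_cancel_left₀ hpj0] at h2
    exact congrArg g (hA₃ a ha a' ha' haa)
  have h0 := sum_normSign_repr_eq_zero hD h2v (ρ := 2 * d) (by omega) hA'u hA'st (A₀.image g) hS1 hS2 hS3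
  rwa [Finset.sum_image hg_inj] at h0

/-- … and its UNIT PART: the non-unit representatives `a ∈ A₀` (the zero class) contribute `ω(C₀)` each (`|C₁ϖ_F^{d−1}a| ≤ |ϖ|^{2d−1}`), so
**`Σ_{a ∈ A₀, |a| = 1} ω(C₀ + C₁ϖ_F^{d−1}a) = −#{a ∈ A₀ : |a| < 1} · ω(C₀)`** (`= −ω(C₀)`: exactly one zero class). [cite: Serre1979, Ch. XV §2] -/
theorem sum_units_normSign_affine_repr_conductor [CompleteSpace K] [Finite 𝓀[K]] (hD : IsRamifiedQuadraticDatum σ ϖ d t) (h2v : Valued.v (2 : K) < 1)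
    {C₀ C₁ : K} (hσC₀ : σ C₀ = C₀) (hC₀ : Valued.v C₀ = 1) (hσC₁ : σ C₁ = C₁) (hC₁ : Valued.v C₁ = 1) (hd : 2 ≤ d)
    (A₀ : Finset K) (hA₁ : ∀ a ∈ A₀, σ a = a ∧ Valued.v a ≤ 1)
    (hA₂ : ∀ u : K, σ u = u → Valued.v u ≤ 1 → ∃ a ∈ A₀, Valued.v (u - a) ≤ Valued.v ϖ ^ 2)
    (hA₃ : ∀ a ∈ A₀, ∀ a' ∈ A₀, Valued.v (a - a') ≤ Valued.v ϖ ^ 2 → a = a') :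
    ∑ a ∈ A₀ with Valued.v a = 1, normSign σ (C₀ + C₁ * (ϖ * σ ϖ) ^ (d - 1) * a) =
      -(((A₀.filter fun a => ¬ Valued.v a = 1).card : ℤ) * normSign σ C₀) := by
  classical
  obtain ⟨hσ, hvσ, hϖ, hfix, -, -, -⟩ := id hD
  have h0 := sum_normSign_affine_repr_conductor_eq_zero hD h2v hσC₀ hC₀ hσC₁ hC₁ hd A₀ hA₁ hA₂ hA₃
  rw [← Finset.sum_filter_add_sum_filter_not A₀ (fun a => Valued.v a = 1)] at h0
  -- the non-unit classes: `|a| ≤ exp(−2)` (fixed, even valuation), so the term is `ω(C₀)`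
  have hnu : ∀ a ∈ A₀.filter (fun a => ¬ Valued.v a = 1), normSign σ (C₀ + C₁ * (ϖ * σ ϖ) ^ (d - 1) * a) = normSign σ C₀ := by
    intro a ha
    rw [Finset.mem_filter] at ha
    obtain ⟨haA, ha1⟩ := ha
    obtain ⟨hσa, hale⟩ := hA₁ a haA
    have hva : Valued.v a ≤ Valued.v ϖ := by
      by_cases ha0 : a = 0
      · rw [ha0, map_zero]; exact zero_le
      · obtain ⟨n, hn⟩ := hfix a hσa ha0
        rw [hn, hϖ]
        rw [hn] at hale ha1
        have hn0 : 2 * n ≤ 0 := by rwa [← exp_zero, exp_le_exp] at hale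
        have hn1 : 2 * n ≠ 0 := fun h => ha1 (by rw [h, exp_zero])
        exact exp_le_exp.2 (by omega)
    refine normSign_eq_of_near hD hσC₀ ?_ hC₀ (n := 2 * d - 1) le_rfl ?_
    · rw [map_add, hσC₀, map_mul, map_mul, map_pow, map_mul, hσ, hσC₁, hσa, mul_comm (σ ϖ) ϖ]
    · rw [show C₀ - (C₀ + C₁ * (ϖ * σ ϖ) ^ (d - 1) * a) = -(C₁ * (ϖ * σ ϖ) ^ (d - 1) * a) by ring, Valuation.map_neg, map_mul, map_mul,
        hC₁, one_mul, map_pow, map_mul, hvσ, ← pow_two, ← pow_mul]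
      calc Valued.v ϖ ^ (2 * (d - 1)) * Valued.v a ≤ Valued.v ϖ ^ (2 * (d - 1)) * Valued.v ϖ := mul_le_mul' le_rfl hva
        _ = Valued.v ϖ ^ (2 * d - 1) := by rw [← pow_succ]; congr 1; omega
  rw [Finset.sum_congr rfl hnu, Finset.sum_const, nsmul_eq_mul] at h0
  linarith

/-! ## §3  (T) The non-unit residues: `r = ϖ·r′` shifts `j` by one (the all-residues recursion `T_j(s) = S_j(s) + T_{j+1}(s−1)`) -/

/-- **(T) THE NON-UNIT RESIDUES.**  Ramified datum on a complete `K`; `C₀` a fixed unit, `C₁` fixed integral; `R` a complete irredundant residue system of `𝒪_K` modulo `ϖ^s` and `R′`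
one modulo `ϖ^{s−1}` (`1 ≤ s`, `2d ≤ 2j + s + 1` so that a `ϖ^s`-perturbation of `N r` does not move the class).  Then `r ↦` (the representative `r′` of `r∕ϖ`) is a bijection from the
NON-unit part of `R` onto `R′` with `ω(C₀ + C₁ϖ_F^jN r) = ω(C₀ + C₁ϖ_F^{j+1}N r′)` (`N(ϖr′) = ϖ_F·N r′`), hence
**`Σ_{r ∈ R, |r| < 1} ω(C₀ + C₁ϖ_F^jN r) = Σ_{r′ ∈ R′} ω(C₀ + C₁ϖ_F^{j+1}N r′)`** — with §1∕FILE 2 this is the recursion `T_j(s) = S_j(s) + T_{j+1}(s − 1)` of LH4-p11 (g8) (Q1).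
[cite: Serre1979, Ch. V §3; Ch. XV §2] -/
theorem sum_nonunits_normSign_binaryNormForm_eq [CompleteSpace K] (hD : IsRamifiedQuadraticDatum σ ϖ d t)
    {C₀ C₁ : K} (hσC₀ : σ C₀ = C₀) (hC₀ : Valued.v C₀ = 1) (hσC₁ : σ C₁ = C₁) (hC₁ : Valued.v C₁ ≤ 1) {j s : ℕ} (hs : 1 ≤ s) (hjs : 2 * d ≤ 2 * j + s + 1)
    (R : Finset K) (hR₁ : ∀ r ∈ R, Valued.v r ≤ 1) (hR₂ : ∀ x : K, Valued.v x ≤ 1 → ∃ r ∈ R, Valued.v (x - r) ≤ Valued.v ϖ ^ s)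
    (hR₃ : ∀ r ∈ R, ∀ r' ∈ R, Valued.v (r - r') ≤ Valued.v ϖ ^ s → r = r')
    (R' : Finset K) (hR'₁ : ∀ r ∈ R', Valued.v r ≤ 1) (hR'₂ : ∀ x : K, Valued.v x ≤ 1 → ∃ r ∈ R', Valued.v (x - r) ≤ Valued.v ϖ ^ (s - 1))
    (hR'₃ : ∀ r ∈ R', ∀ r' ∈ R', Valued.v (r - r') ≤ Valued.v ϖ ^ (s - 1) → r = r') :
    ∑ r ∈ R with ¬ Valued.v r = 1, normSign σ (C₀ + C₁ * (ϖ * σ ϖ) ^ j * (r * σ r)) =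
      ∑ r' ∈ R', normSign σ (C₀ + C₁ * (ϖ * σ ϖ) ^ (j + 1) * (r' * σ r')) := by
  classical
  obtain ⟨hσ, hvσ, hϖ, -, -, -, -⟩ := id hD
  have hϖ0' : Valued.v ϖ ≠ 0 := by rw [hϖ]; exact exp_ne_zero
  have hϖ0 : ϖ ≠ 0 := fun h => by rw [h, map_zero] at hϖ0'; exact hϖ0' rfl
  have hϖ1 : Valued.v ϖ ≤ 1 := by rw [hϖ, ← exp_zero]; exact exp_le_exp.2 (by norm_num)
  have hϖlt : Valued.v ϖ < 1 := by rw [hϖ, ← exp_zero]; exact exp_lt_exp.2 (by norm_num)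
  have hpow : Valued.v ϖ ^ s = Valued.v ϖ * Valued.v ϖ ^ (s - 1) := by rw [← pow_succ', Nat.sub_add_cancel hs]
  -- a non-unit integral `r` is `ϖ·x` with `x` integral
  have hdiv : ∀ r : K, Valued.v r ≤ 1 → ¬ Valued.v r = 1 → Valued.v (r / ϖ) ≤ 1 := by
    intro r hr1 hr
    have hlt : Valued.v r < 1 := lt_of_le_of_ne hr1 hr
    rw [map_div₀, div_le_one₀ (lt_of_le_of_ne zero_le hϖ0'.symm), hϖ]
    rw [← exp_zero] at hlt
    -- discreteness: `v r < exp 0 ⇒ v r ≤ exp (−1)`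
    by_cases hr0 : r = 0
    · rw [hr0, map_zero]; exact zero_le
    · obtain ⟨n, hn⟩ : ∃ n : ℤ, Valued.v r = exp n := ⟨_, (WithZero.coe_unzero ((Valuation.ne_zero_iff _).2 hr0)).symm.trans (by rfl)⟩
      rw [hn] at hlt ⊢; exact exp_le_exp.2 (by have := exp_lt_exp.1 hlt; omega)
  -- the representative map `ψ r := rep_{R'}(r/ϖ)`
  have hψ : ∀ r : K, ∃ r' : K, (Valued.v r ≤ 1 ∧ ¬ Valued.v r = 1) → r' ∈ R' ∧ Valued.v (r / ϖ - r') ≤ Valued.v ϖ ^ (s - 1) := by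
    intro r
    by_cases h : Valued.v r ≤ 1 ∧ ¬ Valued.v r = 1
    · obtain ⟨r', hr', hh⟩ := hR'₂ (r / ϖ) (hdiv r h.1 h.2); exact ⟨r', fun _ => ⟨hr', hh⟩⟩
    · exact ⟨0, fun h' => absurd h' h⟩
  choose ψ hψ using hψ
  have hψ' : ∀ r ∈ R.filter (fun r => ¬ Valued.v r = 1), ψ r ∈ R' ∧ Valued.v (r - ϖ * ψ r) ≤ Valued.v ϖ ^ s := by
    intro r hr
    rw [Finset.mem_filter] at hr
    obtain ⟨hR', hh⟩ := hψ r ⟨hR₁ r hr.1, hr.2⟩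
    refine ⟨hR', ?_⟩
    rw [show r - ϖ * ψ r = ϖ * (r / ϖ - ψ r) by field_simp, map_mul, hpow]
    exact mul_le_mul' le_rfl hh
  refine Finset.sum_bij (fun r _ => ψ r) (fun r hr => (hψ' r hr).1) (fun r₁ hr₁ r₂ hr₂ h => ?_) (fun r' hr' => ?_) (fun r hr => ?_)
  · -- injective
    refine hR₃ r₁ (Finset.mem_filter.1 hr₁).1 r₂ (Finset.mem_filter.1 hr₂).1 ?_
    rw [show r₁ - r₂ = (r₁ - ϖ * ψ r₁) - (r₂ - ϖ * ψ r₂) by rw [h]; ring]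
    exact (Valuation.map_sub _ _ _).trans (max_le (hψ' r₁ hr₁).2 (hψ' r₂ hr₂).2)
  · -- surjective: the `R`-representative of `ϖ r'`
    obtain ⟨r, hr, hrr⟩ := hR₂ (ϖ * r') (by rw [map_mul]; exact mul_le_one' hϖ1 (hR'₁ r' hr'))
    have hrn : ¬ Valued.v r = 1 := by
      intro hr1
      have hlt : Valued.v (ϖ * r' - r) < 1 := lt_of_le_of_lt hrr (by rw [hpow]; exact mul_lt_one_of_lt_of_le hϖlt (pow_le_one₀ zero_le hϖ1))
      have : Valued.v r < 1 := by
        rw [show r = ϖ * r' - (ϖ * r' - r) by ring]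
        refine lt_of_le_of_lt (Valuation.map_sub _ _ _) (max_lt ?_ hlt)
        rw [map_mul]; exact mul_lt_one_of_lt_of_le hϖlt (hR'₁ r' hr')
      exact absurd hr1 this.ne
    have hrf : r ∈ R.filter (fun r => ¬ Valued.v r = 1) := Finset.mem_filter.2 ⟨hr, hrn⟩
    refine ⟨r, hrf, hR'₃ _ (hψ' r hrf).1 _ hr' ?_⟩
    have e1 : ψ r - r' = ϖ⁻¹ * ((ϖ * ψ r - r) - (ϖ * r' - r)) := by field_simp; ring
    have e2 : Valued.v (ϖ * ψ r - r) ≤ Valued.v ϖ ^ s := by rw [← Valuation.map_neg, neg_sub]; exact (hψ' r hrf).2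
    have hb : Valued.v ((ϖ * ψ r - r) - (ϖ * r' - r)) ≤ Valued.v ϖ ^ s := (Valuation.map_sub _ _ _).trans (max_le e2 hrr)
    rw [e1, map_mul, map_inv₀]
    calc (Valued.v ϖ)⁻¹ * Valued.v ((ϖ * ψ r - r) - (ϖ * r' - r)) ≤ (Valued.v ϖ)⁻¹ * Valued.v ϖ ^ s := mul_le_mul' le_rfl hb
      _ = Valued.v ϖ ^ (s - 1) := by rw [hpow, ← mul_assoc, inv_mul_cancel₀ hϖ0', one_mul]
  · -- the value: `ω(C₀ + C₁ϖ_F^j N r) = ω(C₀ + C₁ϖ_F^{j+1} N (ψ r))`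
    have hψR := (hψ' r hr).1
    have hclose := (hψ' r hr).2
    have hu1 : Valued.v (ψ r) ≤ 1 := hR'₁ _ hψR
    have hr1 : Valued.v r ≤ 1 := hR₁ r (Finset.mem_filter.1 hr).1
    have hPu : Valued.v (C₁ * (ϖ * σ ϖ) ^ (j + 1) * (ψ r * σ (ψ r))) < 1 := by
      rw [map_mul, map_mul, map_pow, map_mul, hvσ, ← pow_two, ← pow_mul, map_mul, hvσ]
      calc Valued.v C₁ * Valued.v ϖ ^ (2 * (j + 1)) * (Valued.v (ψ r) * Valued.v (ψ r))
          ≤ 1 * Valued.v ϖ ^ (2 * (j + 1)) * (1 * 1) := by gcongr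
        _ = Valued.v ϖ ^ (2 * (j + 1)) := by rw [one_mul, mul_one, mul_one]
        _ < 1 := by rw [hϖ, ← exp_nsmul, nsmul_eq_mul, mul_neg, mul_one, ← exp_zero]; exact exp_lt_exp.2 (by omega)
    have hg1 : Valued.v (C₀ + C₁ * (ϖ * σ ϖ) ^ (j + 1) * (ψ r * σ (ψ r))) = 1 := by
      rw [Valuation.map_add_eq_of_lt_left _ (by rwa [hC₀]), hC₀]
    refine normSign_eq_of_near hD (map_binaryNormForm hσ hσC₀ hσC₁ (j + 1) (ψ r)) (map_binaryNormForm hσ hσC₀ hσC₁ j r) hg1 (n := 2 * d - 1) le_rfl ?_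
    -- `N r − ϖ_F N(ψ r) = (r − ϖψr)σr + ϖψr·σ(r − ϖψr)`
    have e3 : C₀ + C₁ * (ϖ * σ ϖ) ^ (j + 1) * (ψ r * σ (ψ r)) - (C₀ + C₁ * (ϖ * σ ϖ) ^ j * (r * σ r)) =
        -(C₁ * (ϖ * σ ϖ) ^ j * ((r - ϖ * ψ r) * σ r + (ϖ * ψ r) * σ (r - ϖ * ψ r))) := by
      rw [map_sub, map_mul]; ring
    rw [e3, Valuation.map_neg, map_mul, map_mul, map_pow, map_mul, hvσ, ← pow_two, ← pow_mul]
    have hin : Valued.v ((r - ϖ * ψ r) * σ r + (ϖ * ψ r) * σ (r - ϖ * ψ r)) ≤ Valued.v ϖ ^ s := by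
      refine (Valuation.map_add _ _ _).trans (max_le ?_ ?_)
      · rw [map_mul, hvσ]; exact (mul_le_of_le_one_right' hr1).trans hclose
      · rw [map_mul, hvσ, map_mul]
        exact (mul_le_of_le_one_left' (mul_le_one' hϖ1 hu1)).trans hclose
    calc Valued.v C₁ * Valued.v ϖ ^ (2 * j) * Valued.v ((r - ϖ * ψ r) * σ r + (ϖ * ψ r) * σ (r - ϖ * ψ r))
        ≤ 1 * Valued.v ϖ ^ (2 * j) * Valued.v ϖ ^ s := by gcongr
      _ = Valued.v ϖ ^ (2 * j + s) := by rw [one_mul, ← pow_add]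
      _ ≤ Valued.v ϖ ^ (2 * d - 1) := pow_le_pow_right_of_le_one' hϖ1 (by omega)

end Summit.HodgeConjecture.HodgeConjecture.Cruxes.H413.F0P3cDyRamBinaryNormFormFixedSums

end
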